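import Mathlib
import Summits.Ventures.PercRepro.TriangleCapCubicCore

/-!
# PercRepro — THE CUBIC SIX-CORE, II: a `K₄⁻`-free graph that is cubic on six vertices is `K_{3,3}` or the
prism (p3, gen 42; part 176)

`cubic_six_classification`: if every vertex of a six-set `C` has exactly three neighbours inside `C` and `D`
is `K₄⁻`-free, then `D` induces on `C` either `K_{3,3}` (`IsK33On`) or the prism (`IsPrismOn`, part 175).  The
proof looks from one vertex `v` with neighbours `a, b, c` and non-neighbours `p, q` in `C`: if `a, b, c` are
pairwise non-adjacent, each has its two further neighbours at `p` and `q`, so `D[C] = K(\{v,p,q\}, \{a,b,c\})`;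
if one pair is adjacent, say `a ∼ b` (`prism_of_triangle`), then `K₄⁻`-freeness forbids `c ∼ a`, `c ∼ b` and a
common further neighbour of `a` and `b`, so `a` and `b` take `p` and `q` in some order and part 175's matching
lemma gives the prism `v a b | c p q`.  (Without `K₄⁻`-freeness the classification is the same — the two
cubic graphs on six vertices — but the case analysis is longer.)  Axioms: standard.
-/

namespace PercRepro

namespace TriangleCap

namespace C047

open Finset

variable {V : Type*} [Fintype V] [DecidableEq V]

/-- **THE TRIANGLE CASE:** with `v ∼ a, b, c`, `v ≁ p, q` and `a ∼ b`, the core is a prism: `K₄⁻`-freeness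
forbids a common further neighbour of `a` and `b`, so they take `p` and `q` in some order. -/
theorem prism_of_triangle (D : SimpleGraph V) [DecidableRel D.Adj] (hK : K4mFree D)
    {C : Finset V} {v a b c p q : V} (hCeq : C = {v, a, b, c, p, q}) (hC : C.card = 6)
    (hcub : ∀ c ∈ C, degIn D C c = 3)
    (hva' : v ≠ a) (hvb' : v ≠ b) (hvc' : v ≠ c) (hvp' : v ≠ p) (hvq' : v ≠ q) (hab' : a ≠ b) (hac' : a ≠ c)
    (hap' : a ≠ p) (haq' : a ≠ q) (hbc' : b ≠ c) (hbp' : b ≠ p) (hbq' : b ≠ q) (hcp' : c ≠ p) (hcq' : c ≠ q)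
    (hpq' : p ≠ q) (hva : D.Adj v a) (hvb : D.Adj v b) (hvc : D.Adj v c) (hvp : ¬ D.Adj v p)
    (hvq : ¬ D.Adj v q) (hab : D.Adj a b) : IsPrismOn D C := by
  have hmem : ∀ w ∈ C, w = v ∨ w = a ∨ w = b ∨ w = c ∨ w = p ∨ w = q := by
    intro w hw
    rw [hCeq] at hw
    simpa only [mem_insert, mem_singleton] using hw
  have haC : a ∈ C := by rw [hCeq]; simp
  have hbC : b ∈ C := by rw [hCeq]; simp
  have hac : ¬ D.Adj a c := fun h => not_adj_both D hK hva hvb hab hbc' hvc h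
  have hbc : ¬ D.Adj b c := fun h => not_adj_both D hK hvb hva (D.adj_symm hab) hac' hvc h
  -- `a` has a further neighbour at `p` or `q`, and so has `b`
  have hthird : ∀ x, x ∈ C → x ≠ v → x ≠ c → x ≠ p → x ≠ q → D.Adj v x → ¬ D.Adj x c → D.Adj x p ∨ D.Adj x q := by
    intro x hxC hxv hxc hxp hxq hvx hxc'
    by_contra hcon
    push Not at hcon
    -- the neighbours of `x` inside `C` lie in `{v, a, b}` minus `x` itself: at most two
    have hsub' : C.filter (fun w => D.Adj x w) ⊆ {v, a, b} := by
      intro w hw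
      rw [mem_filter] at hw
      simp only [mem_insert, mem_singleton]
      rcases hmem w hw.1 with rfl | rfl | rfl | rfl | rfl | rfl
      · exact Or.inl rfl
      · exact Or.inr (Or.inl rfl)
      · exact Or.inr (Or.inr rfl)
      · exact absurd hw.2 hxc'
      · exact absurd hw.2 hcon.1
      · exact absurd hw.2 hcon.2
    have hx3 := hcub x hxC
    unfold degIn at hx3
    -- `{v, a, b}` has three elements, but `x ∈ {a, b}` is not its own neighbour: the filter misses `x`
    have hxab : x = a ∨ x = b := by
      rcases hmem x hxC with h | h | h | h | h | h
      · exact absurd h hxv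
      · exact Or.inl h
      · exact Or.inr h
      · exact absurd h hxc
      · exact absurd h hxp
      · exact absurd h hxq
    have hxnot : x ∉ C.filter (fun w => D.Adj x w) := by
      rw [mem_filter]
      exact fun h => D.irrefl h.2
    have hsub'' : C.filter (fun w => D.Adj x w) ⊆ ({v, a, b} : Finset V).erase x := by
      intro w hw
      rw [mem_erase]
      exact ⟨fun h => hxnot (h ▸ hw), hsub' hw⟩
    have hle' := card_le_card hsub''
    rw [hx3, card_erase_of_mem (by rcases hxab with rfl | rfl <;> simp)] at hle'
    have h3 : ({v, a, b} : Finset V).card = 3 := by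
      rw [card_insert_of_notMem, card_pair hab']
      simp only [mem_insert, mem_singleton, not_or]
      exact ⟨hva', hvb'⟩
    omega
  have ha := hthird a haC hva'.symm hac' hap' haq' hva hac
  have hb := hthird b hbC hvb'.symm hbc' hbp' hbq' hvb hbc
  -- no common further neighbour (a `K₄⁻` on `v, a, b` and it)
  have hnp : ¬ (D.Adj a p ∧ D.Adj b p) := fun h =>
    not_adj_both D hK hab (D.adj_symm hva) (D.adj_symm hvb) hvp' h.1 h.2
  have hnq : ¬ (D.Adj a q ∧ D.Adj b q) := fun h =>
    not_adj_both D hK hab (D.adj_symm hva) (D.adj_symm hvb) hvq' h.1 h.2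
  rcases ha with hap | haq
  · rcases hb with hbp | hbq
    · exact absurd ⟨hap, hbp⟩ hnp
    · exact prism_of_triangle_matching D hK hCeq hC hcub hva' hvb' hvc' hvp' hvq' hab' hac' hap' haq' hbc'
        hbp' hbq' hcp' hcq' hpq' hva hvb hvc hvp hvq hab hap hbq
  · rcases hb with hbp | hbq
    · have hCeq' : C = {v, a, b, c, q, p} := by rw [hCeq, pair_comm]
      exact prism_of_triangle_matching D hK hCeq' hC hcub hva' hvb' hvc' hvq' hvp' hab' hac' haq' hap' hbc'
        hbq' hbp' hcq' hcp' hpq'.symm hva hvb hvc hvq hvp hab haq hbp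
    · exact absurd ⟨haq, hbq⟩ hnq

/-- **THE CUBIC SIX-CORE IS `K_{3,3}` OR THE PRISM:** if every vertex of the six-set `C` has exactly three
neighbours in `C` and `D` is `K₄⁻`-free, then `D` induces `K_{3,3}` or the prism on `C`. -/
theorem cubic_six_classification (D : SimpleGraph V) [DecidableRel D.Adj] (hK : K4mFree D) {C : Finset V}
    (hC : C.card = 6) (hcub : ∀ c ∈ C, degIn D C c = 3) : IsK33On D C ∨ IsPrismOn D C := by
  obtain ⟨v, hvC⟩ : C.Nonempty := card_pos.mp (by omega)
  -- the three neighbours of `v`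
  have hNv := hcub v hvC
  unfold degIn at hNv
  obtain ⟨a, b, c, hab', hac', hbc', hN⟩ := card_eq_three.mp hNv
  have hmemN : ∀ w, w ∈ C ∧ D.Adj v w ↔ (w = a ∨ w = b ∨ w = c) := by
    intro w
    have := mem_filter.symm.trans (Iff.of_eq (congrArg (fun s : Finset V => w ∈ s) hN))
    simpa only [mem_insert, mem_singleton] using this
  have haC : a ∈ C := ((hmemN a).mpr (Or.inl rfl)).1
  have hva : D.Adj v a := ((hmemN a).mpr (Or.inl rfl)).2
  have hbC : b ∈ C := ((hmemN b).mpr (Or.inr (Or.inl rfl))).1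
  have hvb : D.Adj v b := ((hmemN b).mpr (Or.inr (Or.inl rfl))).2
  have hcC : c ∈ C := ((hmemN c).mpr (Or.inr (Or.inr rfl))).1
  have hvc : D.Adj v c := ((hmemN c).mpr (Or.inr (Or.inr rfl))).2
  have hva' : v ≠ a := D.ne_of_adj hva
  have hvb' : v ≠ b := D.ne_of_adj hvb
  have hvc' : v ≠ c := D.ne_of_adj hvc
  -- the two non-neighbours of `v`
  have h4sub : ({v, a, b, c} : Finset V) ⊆ C := by
    intro w hw
    simp only [mem_insert, mem_singleton] at hw
    rcases hw with rfl | rfl | rfl | rfl <;> assumption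
  have h4card : ({v, a, b, c} : Finset V).card = 4 := by
    rw [card_insert_of_notMem, card_insert_of_notMem, card_pair hbc']
    · simp only [mem_insert, mem_singleton, not_or]
      exact ⟨hab', hac'⟩
    · simp only [mem_insert, mem_singleton, not_or]
      exact ⟨hva', hvb', hvc'⟩
  have hR : (C \ {v, a, b, c}).card = 2 := by
    rw [card_sdiff_of_subset h4sub, hC, h4card]
  obtain ⟨p, q, hpq', hRpq⟩ := card_eq_two.mp hR
  have hmemR : ∀ w, w ∈ C ∧ w ∉ ({v, a, b, c} : Finset V) ↔ (w = p ∨ w = q) := by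
    intro w
    have := mem_sdiff.symm.trans (Iff.of_eq (congrArg (fun s : Finset V => w ∈ s) hRpq))
    simpa only [mem_insert, mem_singleton] using this
  have hpC : p ∈ C := ((hmemR p).mpr (Or.inl rfl)).1
  have hp4 : p ∉ ({v, a, b, c} : Finset V) := ((hmemR p).mpr (Or.inl rfl)).2
  have hqC : q ∈ C := ((hmemR q).mpr (Or.inr rfl)).1
  have hq4 : q ∉ ({v, a, b, c} : Finset V) := ((hmemR q).mpr (Or.inr rfl)).2
  simp only [mem_insert, mem_singleton, not_or] at hp4 hq4
  obtain ⟨hpv', hpa', hpb', hpc'⟩ := hp4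
  obtain ⟨hqv', hqa', hqb', hqc'⟩ := hq4
  have hpv' : p ≠ v := hpv'
  have hpa' : p ≠ a := hpa'
  have hpb' : p ≠ b := hpb'
  have hpc' : p ≠ c := hpc'
  have hqv' : q ≠ v := hqv'
  have hqa' : q ≠ a := hqa'
  have hqb' : q ≠ b := hqb'
  have hqc' : q ≠ c := hqc'
  have hvp : ¬ D.Adj v p := fun h => by
    rcases (hmemN p).mp ⟨hpC, h⟩ with h1 | h1 | h1
    · exact hpa' h1
    · exact hpb' h1
    · exact hpc' h1
  have hvq : ¬ D.Adj v q := fun h => by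
    rcases (hmemN q).mp ⟨hqC, h⟩ with h1 | h1 | h1
    · exact hqa' h1
    · exact hqb' h1
    · exact hqc' h1
  -- `C = {v, a, b, c, p, q}`
  have hCeq : C = {v, a, b, c, p, q} := by
    symm
    apply eq_of_subset_of_card_le
    · intro w hw
      simp only [mem_insert, mem_singleton] at hw
      rcases hw with rfl | rfl | rfl | rfl | rfl | rfl <;> assumption
    · rw [hC, card_insert_of_notMem, card_insert_of_notMem, card_insert_of_notMem, card_insert_of_notMem,
        card_pair hpq']
      · simp only [mem_insert, mem_singleton, not_or]
        exact ⟨hpc'.symm, hqc'.symm⟩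
      · simp only [mem_insert, mem_singleton, not_or]
        exact ⟨hbc', hpb'.symm, hqb'.symm⟩
      · simp only [mem_insert, mem_singleton, not_or]
        exact ⟨hab', hac', hpa'.symm, hqa'.symm⟩
      · simp only [mem_insert, mem_singleton, not_or]
        exact ⟨hva', hvb', hvc', hpv'.symm, hqv'.symm⟩
  have hmem : ∀ w ∈ C, w = v ∨ w = a ∨ w = b ∨ w = c ∨ w = p ∨ w = q := by
    intro w hw
    rw [hCeq] at hw
    simpa only [mem_insert, mem_singleton] using hw
  by_cases htri : D.Adj a b ∨ D.Adj a c ∨ D.Adj b c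
  · right
    rcases htri with hab | hac | hbc
    · exact prism_of_triangle D hK hCeq hC hcub hva' hvb' hvc' hpv'.symm hqv'.symm hab' hac' hpa'.symm hqa'.symm
        hbc' hpb'.symm hqb'.symm hpc'.symm hqc'.symm hpq' hva hvb hvc hvp hvq hab
    · have hCeq' : C = {v, a, c, b, p, q} := by
        rw [hCeq, Finset.insert_comm c b]
      exact prism_of_triangle D hK hCeq' hC hcub hva' hvc' hvb' hpv'.symm hqv'.symm hac' hab' hpa'.symm hqa'.symm
        hbc'.symm hpc'.symm hqc'.symm hpb'.symm hqb'.symm hpq' hva hvc hvb hvp hvq hac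
    · have hCeq' : C = {v, b, c, a, p, q} := by
        rw [hCeq, Finset.insert_comm a b, Finset.insert_comm a c]
      exact prism_of_triangle D hK hCeq' hC hcub hvb' hvc' hva' hpv'.symm hqv'.symm hbc' hab'.symm hpb'.symm
        hqb'.symm hac'.symm hpc'.symm hqc'.symm hpa'.symm hqa'.symm hpq' hvb hvc hva hvp hvq hbc
  · left
    push Not at htri
    obtain ⟨hab, hac, hbc⟩ := htri
    -- `a, b, c ∼ p, q`
    have hNa := adj_of_nbhd_subset_three D (hcub a haC) hpv'.symm hqv'.symm hpq' (fun w hw haw => by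
      rcases hmem w hw with rfl | rfl | rfl | rfl | rfl | rfl
      · exact Or.inl rfl
      · exact absurd haw D.irrefl
      · exact absurd haw hab
      · exact absurd haw hac
      · exact Or.inr (Or.inl rfl)
      · exact Or.inr (Or.inr rfl))
    obtain ⟨-, hap, haq⟩ := hNa
    have hNb := adj_of_nbhd_subset_three D (hcub b hbC) hpv'.symm hqv'.symm hpq' (fun w hw hbw => by
      rcases hmem w hw with rfl | rfl | rfl | rfl | rfl | rfl
      · exact Or.inl rfl
      · exact absurd (D.adj_symm hbw) hab
      · exact absurd hbw D.irrefl
      · exact absurd hbw hbc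
      · exact Or.inr (Or.inl rfl)
      · exact Or.inr (Or.inr rfl))
    obtain ⟨-, hbp, hbq⟩ := hNb
    have hNc := adj_of_nbhd_subset_three D (hcub c hcC) hpv'.symm hqv'.symm hpq' (fun w hw hcw => by
      rcases hmem w hw with rfl | rfl | rfl | rfl | rfl | rfl
      · exact Or.inl rfl
      · exact absurd (D.adj_symm hcw) hac
      · exact absurd (D.adj_symm hcw) hbc
      · exact absurd hcw D.irrefl
      · exact Or.inr (Or.inl rfl)
      · exact Or.inr (Or.inr rfl))
    obtain ⟨-, hcp, hcq⟩ := hNc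
    -- `p ≁ q`
    have hNp := nbhd_eq_of_three D (hcub p hpC) haC hbC hcC hab' hac' hbc' (D.adj_symm hap) (D.adj_symm hbp)
      (D.adj_symm hcp)
    have hpq : ¬ D.Adj p q := fun h => by
      rcases hNp q hqC h with h1 | h1 | h1
      · exact hqa' h1
      · exact hqb' h1
      · exact hqc' h1
    refine ⟨{v, p, q}, ?_, ?_, ?_⟩
    · intro w hw
      simp only [mem_insert, mem_singleton] at hw
      rcases hw with rfl | rfl | rfl <;> assumption
    · rw [card_insert_of_notMem, card_pair hpq']
      simp only [mem_insert, mem_singleton, not_or]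
      exact ⟨hpv'.symm, hqv'.symm⟩
    · have hav := D.adj_symm hva
      have hbv := D.adj_symm hvb
      have hcv := D.adj_symm hvc
      have hpa := D.adj_symm hap
      have hqa := D.adj_symm haq
      have hpb := D.adj_symm hbp
      have hqb := D.adj_symm hbq
      have hpc := D.adj_symm hcp
      have hqc := D.adj_symm hcq
      have hba : ¬ D.Adj b a := fun h => hab (D.adj_symm h)
      have hca : ¬ D.Adj c a := fun h => hac (D.adj_symm h)
      have hcb : ¬ D.Adj c b := fun h => hbc (D.adj_symm h)
      have hpv : ¬ D.Adj p v := fun h => hvp (D.adj_symm h)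
      have hqv : ¬ D.Adj q v := fun h => hvq (D.adj_symm h)
      have hqp : ¬ D.Adj q p := fun h => hpq (D.adj_symm h)
      have hav' : a ≠ v := hva'.symm
      have hbv' : b ≠ v := hvb'.symm
      have hcv' : c ≠ v := hvc'.symm
      have hap' : a ≠ p := hpa'.symm
      have haq' : a ≠ q := hqa'.symm
      have hbp' : b ≠ p := hpb'.symm
      have hbq' : b ≠ q := hqb'.symm
      have hcp' : c ≠ p := hpc'.symm
      have hcq' : c ≠ q := hqc'.symm
      intro u hu w hw
      rcases hmem u hu with rfl | rfl | rfl | rfl | rfl | rfl <;>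
        rcases hmem w hw with rfl | rfl | rfl | rfl | rfl | rfl <;>
        simp [hva, hvb, hvc, hap, haq, hbp, hbq, hcp, hcq, hav, hbv, hcv, hpa, hqa, hpb, hqb, hpc, hqc,
          hab, hac, hbc, hvp, hvq, hpq, hba, hca, hcb, hpv, hqv, hqp, hav', hbv', hcv', hap', haq', hbp', hbq',
          hcp', hcq', hpv', hqv', hpq']

end C047

end TriangleCap

end PercRepro
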